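import Summits.QuantumAdvantage.QuantumAdvantage.Theses.CubicForrelation
import Summits.QuantumAdvantage.QuantumAdvantage.Theorems.CubicForrelationExactPairsMaioranaMcFarlandDefectVanishing
import Literature.Computability.QuantumComplexity.ForrelationDerivativeTables

/-!
# Crux `CubicForrelation.NearExactIsExact` (stmt-QuantumAdvantage-14043), line `direct-sum-amplification` —
stub FP, part A: Walsh analysis of a Boolean function of three linear forms

Toolkit for the four-point Walsh concentration lemma `stub_fourPoint`
(`CubicForrelationNearExactIsExactFourPoint.lean`), all sorry-free and definition-free.

* **Two finite checks over the `256` Boolean functions `F : 𝔽₂³ → 𝔽₂`**, stated on `ℤ` with the function given by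
  its table of eight values (a `bif` tree applied to a generic statement) and proved by `decide` (`fp_coreA`, `fp_coreB`), then transported to the real Walsh sums
  `Σ_{p,q,r} (-1)^{F(p,q,r)} χ(p,q,r)` (`fp_checkA`, `fp_checkB`):
  (A) `|F̂(0)| + |F̂(e₁)| + |F̂(e₂)| + |F̂(e₃)| ≤ 12` (unnormalised `8`-point sums; `12 = 3/2 · 8 < 15`);
  (B) if the four Walsh sums of the restriction `G(p,q) = F(p,q,p ⊕ q)` to the plane `r = p ⊕ q` — each written as
  `F̂(S) + F̂(S Δ 123)` — have total modulus `> 15`, then `G` is one of the eight quadratic (bent) functions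
  `pq ⊕ αp ⊕ βq ⊕ e` (all four `|Ĝ| = 2`).
* **Fourier expansion on the `3`-cube** (`fp_expand`) and its consequence for sums over `𝔽₂^k` of a function of
  three linear forms `ℓ_{z₂}, ℓ_{z₃}, ℓ_{z₄}` with `z₂, z₃, z₄` distinct and non-zero (`fp_sum_cube`):
  `8 Σ_x H(ℓ_{z₂}x, ℓ_{z₃}x, ℓ_{z₄}x) = 2^k (Ĥ(∅) + [z₄ = z₂ ⊕ z₃] Ĥ(123))` — the only possible linear relation
  among three distinct non-zero vectors is `z₂ ⊕ z₃ ⊕ z₄ = 0` (character orthogonality `sum_twist_left`).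
* The sign formula of the aligned rank-`2` quadratic `(-1)^{ab ⊕ αa ⊕ βb ⊕ e} = (-1)^e (-1)^{x·s} (1 + A + B - AB)/2`
  (`fp_sign_formula`) and the `2`-flat `{0, z₂, z₃, z₂ ⊕ z₃} = s + ⟨z₂, z₃⟩`, `s = αz₂ ⊕ βz₃` (`fp_flat`).

References (orientation; everything here is proved): R. O'Donnell, *Analysis of Boolean Functions* (CUP 2014),
§1.4 (characters, orthogonality, Fourier expansion); F. J. MacWilliams, N. J. A. Sloane, *The Theory of
Error-Correcting Codes* (1977), Ch. 14 §3 (Walsh spectra of quadratic / bent functions on few variables).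
-/

set_option linter.dupNamespace false -- D-0017: single-problem summit ⇒ `QuantumAdvantage.QuantumAdvantage` by design

noncomputable section

namespace Summit.QuantumAdvantage.QuantumAdvantage.Theorems.CubicForrelation.NearExactIsExact

open Finset
open Literature.Computability.QuantumComplexity
open Literature.Computability.QuantumComplexity.BuzetChailloux (bxor zeroVec bxor_zeroVec zeroVec_bxor
  bxor_self bxor_bxor_cancel_left bxor_eq_zeroVec_iff twist_bxor_right twist_zeroVec_right sum_twist_left)

/-! ### The two finite checks (integers, by `decide`) -/

set_option maxRecDepth 4000 in
/-- **Finite check A** (all `256` Boolean functions `F` on `𝔽₂³`, by `decide`): the unnormalised Walsh sums of `F` at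
`0, e₁, e₂, e₃` have total modulus `≤ 12`. [folklore] -/
theorem fp_coreA : ∀ f₀ f₁ f₂ f₃ f₄ f₅ f₆ f₇ : Bool,
    (fun F : Bool → Bool → Bool → Bool =>
      |∑ p, ∑ q, ∑ r, (if F p q r then (-1 : ℤ) else 1)| +
        |∑ p, ∑ q, ∑ r, (if F p q r then (-1 : ℤ) else 1) * (if p then (-1 : ℤ) else 1)| +
        |∑ p, ∑ q, ∑ r, (if F p q r then (-1 : ℤ) else 1) * (if q then (-1 : ℤ) else 1)| +
        |∑ p, ∑ q, ∑ r, (if F p q r then (-1 : ℤ) else 1) * (if r then (-1 : ℤ) else 1)| ≤ 12)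
      (fun p q r => bif p then (bif q then (bif r then f₀ else f₁) else (bif r then f₂ else f₃))
        else (bif q then (bif r then f₄ else f₅) else (bif r then f₆ else f₇))) := by
  decide

set_option maxRecDepth 4000 in
/-- **Finite check B** (all `256` Boolean functions `F` on `𝔽₂³`, by `decide`): if the four Walsh sums of the restriction
`G(p,q) = F(p,q,p ⊕ q)` (written as sums of two cube sums) have total modulus `> 15`, then `G = pq ⊕ αp ⊕ βq ⊕ e`.
[folklore] -/
theorem fp_coreB : ∀ f₀ f₁ f₂ f₃ f₄ f₅ f₆ f₇ : Bool,
    (fun F : Bool → Bool → Bool → Bool =>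
      15 < |(∑ p, ∑ q, ∑ r, (if F p q r then (-1 : ℤ) else 1)) +
            ∑ p, ∑ q, ∑ r, (if F p q r then (-1 : ℤ) else 1) *
              ((if p then (-1 : ℤ) else 1) * ((if q then (-1 : ℤ) else 1) * (if r then (-1 : ℤ) else 1)))| +
        |(∑ p, ∑ q, ∑ r, (if F p q r then (-1 : ℤ) else 1) * (if p then (-1 : ℤ) else 1)) +
            ∑ p, ∑ q, ∑ r, (if F p q r then (-1 : ℤ) else 1) * (if p then (-1 : ℤ) else 1) *
              ((if p then (-1 : ℤ) else 1) * ((if q then (-1 : ℤ) else 1) * (if r then (-1 : ℤ) else 1)))| +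
        |(∑ p, ∑ q, ∑ r, (if F p q r then (-1 : ℤ) else 1) * (if q then (-1 : ℤ) else 1)) +
            ∑ p, ∑ q, ∑ r, (if F p q r then (-1 : ℤ) else 1) * (if q then (-1 : ℤ) else 1) *
              ((if p then (-1 : ℤ) else 1) * ((if q then (-1 : ℤ) else 1) * (if r then (-1 : ℤ) else 1)))| +
        |(∑ p, ∑ q, ∑ r, (if F p q r then (-1 : ℤ) else 1) * (if r then (-1 : ℤ) else 1)) +
            ∑ p, ∑ q, ∑ r, (if F p q r then (-1 : ℤ) else 1) * (if r then (-1 : ℤ) else 1) *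
              ((if p then (-1 : ℤ) else 1) * ((if q then (-1 : ℤ) else 1) * (if r then (-1 : ℤ) else 1)))| →
      ∃ α β e : Bool, ∀ p q : Bool, F p q (p ^^ q) = ((p && q) ^^ ((α && p) ^^ ((β && q) ^^ e))))
      (fun p q r => bif p then (bif q then (bif r then f₀ else f₁) else (bif r then f₂ else f₃))
        else (bif q then (bif r then f₄ else f₅) else (bif r then f₆ else f₇))) := by
  decide

/-- Reading a Boolean function on the `3`-cube off its table. [folklore] -/
theorem fp_tab_apply (F : Bool → Bool → Bool → Bool) (p q r : Bool) :
    (bif p then (bif q then (bif r then F true true true else F true true false)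
        else (bif r then F true false true else F true false false))
      else (bif q then (bif r then F false true true else F false true false)
        else (bif r then F false false true else F false false false))) = F p q r := by
  cases p <;> cases q <;> cases r <;> rfl

/-! ### The checks on the real side -/

/-- Finite check A for the real Walsh sums `Σ (-1)^{F} χ`, `χ ∈ {1, (-1)^p, (-1)^q, (-1)^r}`. [folklore] -/
theorem fp_checkA (F : Bool → Bool → Bool → Bool) :
    |∑ p, ∑ q, ∑ r, signOf (F p q r)| + |∑ p, ∑ q, ∑ r, signOf (F p q r) * signOf p| +
      |∑ p, ∑ q, ∑ r, signOf (F p q r) * signOf q| + |∑ p, ∑ q, ∑ r, signOf (F p q r) * signOf r| ≤ 12 := by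
  have key := fp_coreA (F true true true) (F true true false) (F true false true) (F true false false)
    (F false true true) (F false true false) (F false false true) (F false false false)
  simp only [fp_tab_apply F] at key
  have cast := (Int.cast_le (R := ℝ)).2 key
  push_cast at cast
  simpa only [signOf] using cast

/-- Finite check B for the real Walsh sums. [folklore] -/
theorem fp_checkB (F : Bool → Bool → Bool → Bool)
    (h : 15 < |(∑ p, ∑ q, ∑ r, signOf (F p q r)) +
          ∑ p, ∑ q, ∑ r, signOf (F p q r) * (signOf p * (signOf q * signOf r))| +
      |(∑ p, ∑ q, ∑ r, signOf (F p q r) * signOf p) +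
          ∑ p, ∑ q, ∑ r, signOf (F p q r) * signOf p * (signOf p * (signOf q * signOf r))| +
      |(∑ p, ∑ q, ∑ r, signOf (F p q r) * signOf q) +
          ∑ p, ∑ q, ∑ r, signOf (F p q r) * signOf q * (signOf p * (signOf q * signOf r))| +
      |(∑ p, ∑ q, ∑ r, signOf (F p q r) * signOf r) +
          ∑ p, ∑ q, ∑ r, signOf (F p q r) * signOf r * (signOf p * (signOf q * signOf r))|) :
    ∃ α β e : Bool, ∀ p q : Bool, F p q (p ^^ q) = ((p && q) ^^ ((α && p) ^^ ((β && q) ^^ e))) := by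
  have key := fp_coreB (F true true true) (F true true false) (F true false true) (F true false false)
    (F false true true) (F false true false) (F false false true) (F false false false)
  simp only [fp_tab_apply F] at key
  refine key ?_
  rw [← Int.cast_lt (R := ℝ)]
  push_cast
  simpa only [signOf] using h

/-! ### Bit-vector bookkeeping -/

/-- `b ⊕ (a ⊕ b) = a`. [folklore] -/
theorem fp_c2 {k : ℕ} (a b : Fin k → Bool) : bxor b (bxor a b) = a := by
  funext i; show (b i ^^ (a i ^^ b i)) = a i; cases a i <;> cases b i <;> decide

/-- `(a ⊕ b) ⊕ a = b`. [folklore] -/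
theorem fp_c3 {k : ℕ} (a b : Fin k → Bool) : bxor (bxor a b) a = b := by
  funext i; show ((a i ^^ b i) ^^ a i) = b i; cases a i <;> cases b i <;> decide

/-- `a ⊕ (b ⊕ c) = 0 ↔ a ⊕ b = c`. [folklore] -/
theorem fp_dep_iff {k : ℕ} (a b c : Fin k → Bool) : bxor a (bxor b c) = zeroVec ↔ bxor a b = c := by
  rw [bxor_eq_zeroVec_iff]
  constructor
  · rintro rfl
    exact fp_c3 b c
  · rintro rfl
    exact (fp_c2 a b).symm

/-- `signOf` is injective. [folklore] -/
theorem fp_signOf_inj (a b : Bool) (h : signOf a = signOf b) : a = b := by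
  cases a <;> cases b <;> first | rfl | (exfalso; norm_num [signOf] at h)

/-- `|𝔽₂^k| • c = 2^k c`. [folklore] -/
theorem fp_card_nsmul (k : ℕ) (c : ℝ) : Fintype.card (Fin k → Bool) • c = (2 : ℝ) ^ k * c := by
  rw [Fintype.card_fun, Fintype.card_bool, Fintype.card_fin, nsmul_eq_mul]
  push_cast
  ring

/-- `8a = 2^k C ⇒ |a| = (2^k/8)|C|`. [folklore] -/
theorem fp_abs_eq (k : ℕ) {a C : ℝ} (h : 8 * a = (2 : ℝ) ^ k * C) : |a| = (2 : ℝ) ^ k / 8 * |C| := by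
  rw [show a = (2 : ℝ) ^ k / 8 * C by linarith, abs_mul, abs_of_pos (by positivity)]

/-! ### Fourier expansion on the `3`-cube and sums of a function of three linear forms -/

/-- **Fourier expansion on the `3`-cube**: `8 H = Σ_S Ĥ(S) χ_S`, the eight coefficients `Ĥ(S) = Σ H χ_S` written
out. [cite: ODonnell2014, §1.4] -/
theorem fp_expand (H : Bool → Bool → Bool → ℝ) (p q r : Bool) :
    8 * H p q r = (∑ a, ∑ b, ∑ c, H a b c) + (∑ a, ∑ b, ∑ c, H a b c * signOf a) * signOf p +
      (∑ a, ∑ b, ∑ c, H a b c * signOf b) * signOf q + (∑ a, ∑ b, ∑ c, H a b c * signOf c) * signOf r +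
      (∑ a, ∑ b, ∑ c, H a b c * (signOf a * signOf b)) * (signOf p * signOf q) +
      (∑ a, ∑ b, ∑ c, H a b c * (signOf a * signOf c)) * (signOf p * signOf r) +
      (∑ a, ∑ b, ∑ c, H a b c * (signOf b * signOf c)) * (signOf q * signOf r) +
      (∑ a, ∑ b, ∑ c, H a b c * (signOf a * (signOf b * signOf c))) * (signOf p * (signOf q * signOf r)) := by
  cases p <;> cases q <;> cases r <;> simp [signOf] <;> ring

/-- **Sums of a function of three linear forms.** For distinct non-zero `z₂, z₃, z₄` and Boolean `ℓ_i` with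
`(-1)^{ℓ_i(x)} = (-1)^{x·z_i}`, and any `H : 𝔽₂³ → ℝ`:
`8 Σ_x H(ℓ₂x, ℓ₃x, ℓ₄x) = 2^k (Σ H + [z₂ ⊕ z₃ = z₄] Σ H χ_{123})` — expand `H` (`fp_expand`); the character `χ_S` becomes
`(-1)^{x·z_S}`, `z_S = ⊕_{i ∈ S} z_i`, whose sum over `x` is `2^k [z_S = 0]` (`sum_twist_left`), and `z_S ≠ 0` unless
`S = ∅` or (`S = {2,3,4}` and `z₂ ⊕ z₃ ⊕ z₄ = 0`). [cite: ODonnell2014, §1.4] -/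
theorem fp_sum_cube :
    ∀ {k : ℕ} {z₂ z₃ z₄ : Fin k → Bool} {l₂ l₃ l₄ : (Fin k → Bool) → Bool},
      (∀ x, signOf (l₂ x) = twist x z₂) → (∀ x, signOf (l₃ x) = twist x z₃) → (∀ x, signOf (l₄ x) = twist x z₄) →
      z₂ ≠ zeroVec → z₃ ≠ zeroVec → z₄ ≠ zeroVec → z₂ ≠ z₃ → z₂ ≠ z₄ → z₃ ≠ z₄ →
      ∀ (H : Bool → Bool → Bool → ℝ), 8 * ∑ x, H (l₂ x) (l₃ x) (l₄ x) = (2 : ℝ) ^ k * ((∑ p, ∑ q, ∑ r, H p q r) +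
        if bxor z₂ z₃ = z₄ then ∑ p, ∑ q, ∑ r, H p q r * (signOf p * (signOf q * signOf r)) else 0) := by
  intro k z₂ z₃ z₄ l₂ l₃ l₄ hl₂ hl₃ hl₄ h₂ h₃ h₄ h₂₃ h₂₄ h₃₄ H
  rw [mul_sum]
  simp_rw [fp_expand H, hl₂, hl₃, hl₄, ← twist_bxor_right]
  simp only [sum_add_distrib, ← mul_sum, sum_const, card_univ, fp_card_nsmul, sum_twist_left]
  have e₂₃ : bxor z₂ z₃ ≠ zeroVec := fun h => h₂₃ ((bxor_eq_zeroVec_iff _ _).1 h)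
  have e₂₄ : bxor z₂ z₄ ≠ zeroVec := fun h => h₂₄ ((bxor_eq_zeroVec_iff _ _).1 h)
  have e₃₄ : bxor z₃ z₄ ≠ zeroVec := fun h => h₃₄ ((bxor_eq_zeroVec_iff _ _).1 h)
  rw [if_neg h₂, if_neg h₃, if_neg h₄, if_neg e₂₃, if_neg e₂₄, if_neg e₃₄]
  by_cases hdep : bxor z₂ z₃ = z₄
  · rw [if_pos hdep, if_pos ((fp_dep_iff _ _ _).2 hdep)]; ring
  · rw [if_neg hdep, if_neg (mt (fp_dep_iff _ _ _).1 hdep)]; ring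

/-! ### The aligned rank-two quadratic: sign formula and the flat -/

/-- **Sign of the aligned rank-`2` quadratic**: for bits `a, b` with `(-1)^a = (-1)^{x·z₂}`, `(-1)^b = (-1)^{x·z₃}`,
`(-1)^{ab ⊕ αa ⊕ βb ⊕ e} = (-1)^e (-1)^{(αz₂ ⊕ βz₃)·x} (1 + A + B - AB)/2` with `A = (-1)^{z₂·x}`, `B = (-1)^{z₃·x}`.
[folklore] -/
theorem fp_sign_formula {k : ℕ} {z₂ z₃ x : Fin k → Bool} {a b : Bool}
    (ha : signOf a = twist x z₂) (hb : signOf b = twist x z₃) (α β e : Bool) :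
    signOf ((a && b) ^^ ((α && a) ^^ ((β && b) ^^ e))) =
      signOf e * twist (bxor (if α then z₂ else zeroVec) (if β then z₃ else zeroVec)) x *
        ((1 + twist z₂ x + twist z₃ x - twist z₂ x * twist z₃ x) / 2) := by
  have h1 : twist (bxor (if α then z₂ else zeroVec) (if β then z₃ else zeroVec)) x =
      (if α then signOf a else 1) * (if β then signOf b else 1) := by
    rw [twist_comm, twist_bxor_right]
    cases α <;> cases β <;> simp [ha, hb, twist_zeroVec_right]
  rw [h1, twist_comm z₂ x, twist_comm z₃ x, ← ha, ← hb]
  cases a <;> cases b <;> cases α <;> cases β <;> cases e <;> norm_num [signOf]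

/-- **The flat.** `{0, z₂, z₃, z₂ ⊕ z₃} = {s, s ⊕ z₂, s ⊕ z₃, s ⊕ z₂ ⊕ z₃}` for `s = αz₂ ⊕ βz₃` (as finsets). [folklore] -/
theorem fp_flat {k : ℕ} (z₂ z₃ : Fin k → Bool) (α β : Bool) :
    ({zeroVec, z₂, z₃, bxor z₂ z₃} : Finset (Fin k → Bool)) =
      {bxor (if α then z₂ else zeroVec) (if β then z₃ else zeroVec),
        bxor (bxor (if α then z₂ else zeroVec) (if β then z₃ else zeroVec)) z₂,
        bxor (bxor (if α then z₂ else zeroVec) (if β then z₃ else zeroVec)) z₃,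
        bxor (bxor (if α then z₂ else zeroVec) (if β then z₃ else zeroVec)) (bxor z₂ z₃)} := by
  cases α <;> cases β <;>
    simp only [Bool.false_eq_true, ↓reduceIte, bxor_zeroVec, zeroVec_bxor, bxor_self, bxor_bxor_cancel_left,
      fp_c2, fp_c3, ExactPairsMaioranaMcFarland.dv_bxor_cancel_right, BuzetChailloux.bxor_comm z₃ z₂] <;>
    ext y <;> simp only [mem_insert, mem_singleton] <;> tauto

end Summit.QuantumAdvantage.QuantumAdvantage.Theorems.CubicForrelation.NearExactIsExact
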